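import Literature.Geometry.Lorentzian.DataEmbeddingChartMetric
import Literature.Geometry.Lorentzian.EinsteinTensorNaturality
import Literature.Geometry.Manifold.InjOnLocalDiffeomorphInverse
import HarnessLib

/-!
# The metric of a spacetime read along an equidimensional immersion of an open subset of a
# normed space: its components, the vacuum equations for them, and the transport of Killing
# fields

Dictionary file (everything proved; the definitions are transports). Let `g` be a `C^∞`
pseudo-Riemannian metric on a manifold `M` modelled on `EuclideanSpace ℝ (Fin m)`, `V : Opens E'`
an open subset of a normed space `E'` of the same dimension, and `Φ : V → M` a `C^∞` map all of
whose differentials are injective (e.g. an inverse chart followed by a change of coordinates —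
the generalisation of `CoordChart.inv` of `DataEmbeddingChartMetric.lean` needed for the
second-order Gaussian slice charts of `CoordGaussianSlice.lean`, which live on `ℝ × ℝ³` rather
than on `ℝ⁴`). Then:

* `ImmersionChart.metric g hΦ hΦ' hdim = Φ^* g` (`PseudoRiemannianMetric.comap`) on `V` and its
  representative `ImmersionChart.repr : E' → E' →L E' →L ℝ` (`metric_val_eq_repr`,
  `repr_apply_of_mem : repr u a b = g_{Φ u}(dΦ a, dΦ b)`);
* `isMetricOn_repr` — the representative is smooth, symmetric and nondegenerate on `V`
  (`MetricCoord.IsMetricOn`, the input format of the coordinate tensor calculus);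
* `ricAt_repr_eq_zero` — for Ricci-flat `g` the coordinate Ricci form of the representative
  vanishes on `V` (`Ric(Φ^*g) = Φ^* Ric(g)`, O'Neill 1983, Ch. 3, Prop. 3.59, and
  `OpensChart.ricci_eq_ricAt`);
* **`exists_isKillingFieldOn_of_coord`** — transport of Killing fields: if `Φ` extends to a map
  `Φext` of `E'` injective with bijective differentials on an open `W₀ ⊆ V`, and `ξ̃ : E' → E'` is
  `C^∞` on `W₀` and satisfies the coordinate Killing equation
  `DG_x(ξ̃ x)(v, w) + G_x(Dξ̃_x v, w) + G_x(v, Dξ̃_x w) = 0` there (`G` the representative), then the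
  pushed-forward field `ξ (Φext u) = dΦext_u (ξ̃ u)` is a Killing field of `g` on the open set
  `Φext '' W₀` in the sense of the tree (`C^∞` as a section of `TM` on it, and
  `g(∇_{Y₀} ξ, Z₀) + g(Y₀, ∇_{Z₀} ξ) = 0` there; O'Neill 1983, Ch. 9, Prop. 9.25 with Ch. 3,
  Prop. 3.59).

## References

* B. O'Neill, *Semi-Riemannian geometry with applications to relativity*, Academic Press 1983,
  Ch. 3, Prop. 3.13, Lemma 3.52, Prop. 3.59; Ch. 9, Prop. 9.25. [ONeill1983]
* J. M. Lee, *Introduction to Smooth Manifolds*, 2nd ed., GTM 218 (2013), Thm. 4.5.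
  [LeeSmoothManifolds2013]
-/

noncomputable section

set_option maxSynthPendingDepth 3

open Bundle Set Function Filter VectorField TopologicalSpace Manifold
open scoped Manifold ContDiff Topology

namespace Literature.Geometry.Lorentzian

namespace ImmersionChart

variable {E' : Type*} [NormedAddCommGroup E'] [NormedSpace ℝ E'] [FiniteDimensional ℝ E']
  {m : ℕ} {M : Type*} [TopologicalSpace M] [ChartedSpace (EuclideanSpace ℝ (Fin m)) M]
  [IsManifold (𝓡 m) ∞ M]
  (g : PseudoRiemannianMetric (𝓡 m) ∞ (EuclideanSpace ℝ (Fin m)) (TangentSpace (𝓡 m) : M → Type _))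
  {V : Opens E'} {Φ : V → M} (hΦ : ContMDiff 𝓘(ℝ, E') (𝓡 m) (∞ + 1) Φ)
  (hΦ' : ∀ u, Function.Injective (mfderiv 𝓘(ℝ, E') (𝓡 m) Φ u))
  (hdim : Module.finrank ℝ E' = Module.finrank ℝ (EuclideanSpace ℝ (Fin m)))

/-! ### The transported metric and its representative -/

/-- **The metric transported along the immersion**: `Φ^* g` on the open submanifold `V`,
`(Φ^* g)_u(a, b) = g_{Φ u}(dΦ a, dΦ b)`. [cite: ONeill1983, Ch. 3, pp. 90–91] -/
def metric : PseudoRiemannianMetric 𝓘(ℝ, E') ∞ E' (TangentSpace 𝓘(ℝ, E') : V → Type _) :=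
  g.comap PseudoRiemannianMetric.contMDiff_pullbackBilin_holds Φ hΦ hΦ' hdim

/-- `(Φ^* g)_u(a, b) = g_{Φ u}(dΦ_u a, dΦ_u b)`. [cite: ONeill1983, Ch. 3, pp. 90–91] -/
@[simp]
theorem metric_val (u : V) (a b : E') :
    (metric g hΦ hΦ' hdim).val u a b =
      g.val (Φ u) (mfderiv 𝓘(ℝ, E') (𝓡 m) Φ u a) (mfderiv 𝓘(ℝ, E') (𝓡 m) Φ u b) :=
  rfl

/-- The representative of the transported metric on all of `E'` (junk value `0` off `V`).
[folklore] -/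
def repr : E' → E' →L[ℝ] E' →L[ℝ] ℝ :=
  fun p ↦ by
    classical
    exact if hp : p ∈ V then (metric g hΦ hΦ' hdim).val ⟨p, hp⟩ else 0

/-- The representative represents: `(Φ^* g).val u = repr u` on `V`. [folklore] -/
theorem metric_val_eq_repr : ∀ u : V, (metric g hΦ hΦ' hdim).val u = repr g hΦ hΦ' hdim u := fun u ↦ by
  have hu : (u : E') ∈ V := u.2
  simp only [repr, dif_pos hu]

/-- The representative at a point of `V`. [folklore] -/
theorem repr_apply_of_mem {p : E'} (hp : p ∈ V) (a b : E') :
    repr g hΦ hΦ' hdim p a b =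
      g.val (Φ ⟨p, hp⟩) (mfderiv 𝓘(ℝ, E') (𝓡 m) Φ ⟨p, hp⟩ a) (mfderiv 𝓘(ℝ, E') (𝓡 m) Φ ⟨p, hp⟩ b) := by
  rw [← metric_val_eq_repr g hΦ hΦ' hdim ⟨p, hp⟩]
  rfl

/-- **The representative is smooth, symmetric and nondegenerate on `V`.** [folklore] -/
theorem isMetricOn_repr : MetricCoord.IsMetricOn (repr g hΦ hΦ' hdim) (V : Set E') :=
  OpensChart.isMetricOn_repr (metric_val_eq_repr g hΦ hΦ' hdim)

/-- **The vacuum equations along the immersion.** If `Ric(g) = 0` then the coordinate Ricci form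
of the representative vanishes on `V`. [cite: ONeill1983, Ch. 3, Prop. 3.59] -/
theorem ricAt_repr_eq_zero [Fact (1 ≤ m)] [g.HasLeviCivita] (hRic : g.IsRicciFlat) {p : E'}
    (hp : p ∈ V) (Y₀ Z₀ : E') :
    MetricCoord.ricAt (repr g hΦ hΦ' hdim) p Y₀ Z₀ = 0 := by
  haveI hLC : (metric g hΦ hΦ' hdim).HasLeviCivita := (metric g hΦ hΦ' hdim).hasLeviCivita
  haveI hLC' : (g.comap PseudoRiemannianMetric.contMDiff_pullbackBilin_holds Φ hΦ hΦ' hdim).HasLeviCivita :=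
    hLC
  have h1 := OpensChart.ricci_eq_ricAt (metric_val_eq_repr g hΦ hΦ' hdim) ⟨p, hp⟩ Y₀ Z₀
  rw [← h1]
  have key : (metric g hΦ hΦ' hdim).ricci ⟨p, hp⟩ Y₀ Z₀ = g.ricci (Φ ⟨p, hp⟩)
      (mfderiv 𝓘(ℝ, E') (𝓡 m) Φ ⟨p, hp⟩ Y₀) (mfderiv 𝓘(ℝ, E') (𝓡 m) Φ ⟨p, hp⟩ Z₀) :=
    PseudoRiemannianMetric.ricci_comap_apply g PseudoRiemannianMetric.contMDiff_pullbackBilin_holds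
      (Φ := Φ) hΦ hΦ' hdim ⟨p, hp⟩ Y₀ Z₀
  rw [key, hRic (Φ ⟨p, hp⟩)]
  rfl

/-! ### Transport of Killing fields along the immersion -/

omit [FiniteDimensional ℝ E'] [IsManifold (𝓡 m) ∞ M] in
/-- The differential of an extension `Φext` of `Φ` to `E'` at a point of `V` is the differential of
`Φ` (`d(Subtype.val) = id`). [folklore] -/
theorem mfderiv_ext_eq {Φext : E' → M} (hext : ∀ u : V, Φ u = Φext u)
    (hsm : ContMDiffOn 𝓘(ℝ, E') (𝓡 m) ∞ Φext V) (u : V) :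
    mfderiv 𝓘(ℝ, E') (𝓡 m) Φext u = mfderiv 𝓘(ℝ, E') (𝓡 m) Φ u := by
  have hΦeq : Φ = Φext ∘ Subtype.val := funext fun u ↦ hext u
  have hd : MDifferentiableAt 𝓘(ℝ, E') (𝓡 m) Φext u.1 :=
    (hsm.contMDiffAt (V.2.mem_nhds u.2)).mdifferentiableAt (by simp)
  rw [hΦeq, mfderiv_comp_subtypeVal hd]

omit [IsManifold (𝓡 m) ∞ M] in
include hΦ' hdim in
/-- The differentials of an extension of `Φ` are bijective at the points of `V`. [folklore] -/
theorem bijective_mfderiv_ext {Φext : E' → M} (hext : ∀ u : V, Φ u = Φext u)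
    (hsm : ContMDiffOn 𝓘(ℝ, E') (𝓡 m) ∞ Φext V) {p : E'} (hp : p ∈ V) :
    Function.Bijective (mfderiv 𝓘(ℝ, E') (𝓡 m) Φext p) := by
  have h := mfderiv_ext_eq (Φ := Φ) hext hsm ⟨p, hp⟩
  simp only at h
  rw [h]
  exact mfderiv_bijective_of_injective (hΦ' ⟨p, hp⟩) hdim

omit [FiniteDimensional ℝ E'] in
/-- The coordinate identity behind the Killing equation: for a coordinate metric `G`,
`G(Γ(Y, ξ), Z) + G(Y, Γ(Z, ξ)) = DG(ξ)(Y, Z)` (`2 G(Γ(X, Y), Z) = K(X, Y, Z)` and the symmetry of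
`DG`). [cite: ONeill1983, Ch. 3, Prop. 3.13] -/
theorem apply_chrAt_add_apply_chrAt {G : E' → E' →L[ℝ] E' →L[ℝ] ℝ} {U : Set E'}
    (hG : MetricCoord.IsMetricOn G U) {x : E'} (hx : x ∈ U) (ξ Y Z : E') :
    G x (MetricCoord.chrAt G x Y ξ) Z + G x Y (MetricCoord.chrAt G x Z ξ) =
      fderiv ℝ G x ξ Y Z := by
  rw [hG.symm x hx Y (MetricCoord.chrAt G x Z ξ), MetricCoord.apply_chrAt (hG.isInvertible x hx),
    MetricCoord.apply_chrAt (hG.isInvertible x hx), MetricCoord.koszulCLM_apply,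
    MetricCoord.koszulCLM_apply, hG.fderiv_symm hx ξ Z Y, hG.fderiv_symm hx Z Y ξ,
    hG.fderiv_symm hx Y Z ξ]
  ring

include hΦ' hdim in
/-- **Transport of Killing fields along the immersion.** Let `Φext : E' → M` extend `Φ`, be `C^∞`
on `V`, injective on an open `W₀ ⊆ V`; let `ξ̃ : E' → E'` be `C^∞` on `W₀` and satisfy the
coordinate Killing equation `DG_x(ξ̃ x)(v, w) + G_x(Dξ̃_x v, w) + G_x(v, Dξ̃_x w) = 0` on `W₀` for
the representative `G` of `Φ^* g`. Then `Φext '' W₀` is open and the pushed-forward field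
`ξ (Φext u) = dΦext_u (ξ̃ u)` is `C^∞` on it and Killing there:
`g(∇_{Y₀} ξ, Z₀) + g(Y₀, ∇_{Z₀} ξ) = 0` (the Killing equation is natural under the local isometry
`Φ : (W₀, Φ^*g) → (M, g)`, O'Neill 1983, Ch. 9, Prop. 9.25 with Ch. 3, Prop. 3.59; in the chart
`∇_{Y}ξ̃ = Dξ̃ Y + Γ(Y, ξ̃)`, Ch. 3, Prop. 3.13, and `G(Γ(Y,ξ̃),Z) + G(Y,Γ(Z,ξ̃)) = DG(ξ̃)(Y,Z)`).
[cite: ONeill1983, Ch. 9, Prop. 9.25] -/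
theorem exists_killing_of_coord [g.HasLeviCivita] {W₀ : Set E'} (hW₀ : IsOpen W₀)
    (hWV : W₀ ⊆ V) {Φext : E' → M} (hext : ∀ u : V, Φ u = Φext u)
    (hsm : ContMDiffOn 𝓘(ℝ, E') (𝓡 m) ∞ Φext V) (hinj : InjOn Φext W₀)
    {ξc : E' → E'} (hξ : ContDiffOn ℝ ∞ ξc W₀)
    (hkill : ∀ x ∈ W₀, ∀ v w : E',
      fderiv ℝ (repr g hΦ hΦ' hdim) x (ξc x) v w + repr g hΦ hΦ' hdim x (fderiv ℝ ξc x v) w +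
        repr g hΦ hΦ' hdim x v (fderiv ℝ ξc x w) = 0) :
    ∃ ξ : Π p : M, TangentSpace (𝓡 m) p,
      IsOpen (Φext '' W₀) ∧
      ContMDiffOn (𝓡 m) ((𝓡 m).prod 𝓘(ℝ, EuclideanSpace ℝ (Fin m))) ∞
        (fun p ↦ (TotalSpace.mk' (EuclideanSpace ℝ (Fin m)) p (ξ p) : TangentBundle (𝓡 m) M))
        (Φext '' W₀) ∧
      (∀ p ∈ Φext '' W₀, ∀ Y₀ Z₀ : TangentSpace (𝓡 m) p,
        g.val p (g.leviCivita ξ p Y₀) Z₀ + g.val p Y₀ (g.leviCivita ξ p Z₀) = 0) ∧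
      ∀ u ∈ W₀, ξ (Φext u) = mfderiv 𝓘(ℝ, E') (𝓡 m) Φext u (ξc u) := by
  haveI hLC : (metric g hΦ hΦ' hdim).HasLeviCivita := (metric g hΦ hΦ' hdim).hasLeviCivita
  haveI hLC' : (g.comap PseudoRiemannianMetric.contMDiff_pullbackBilin_holds Φ hΦ hΦ' hdim).HasLeviCivita :=
    hLC
  have hG := metric_val_eq_repr g hΦ hΦ' hdim
  have hmet : MetricCoord.IsMetricOn (repr g hΦ hΦ' hdim) (V : Set E') := isMetricOn_repr g hΦ hΦ' hdim
  -- the local diffeomorphism `Φext|W₀` and its inverse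
  have hsmW : ContMDiffOn 𝓘(ℝ, E') (𝓡 m) ∞ Φext W₀ := hsm.mono hWV
  have hbij : ∀ x ∈ W₀, Function.Bijective (mfderiv 𝓘(ℝ, E') (𝓡 m) Φext x) := fun x hx ↦
    bijective_mfderiv_ext hΦ' hdim hext hsm (hWV hx)
  have hWopen : IsOpen (Φext '' W₀) :=
    Literature.Geometry.Manifold.isOpen_image_of_bijective_mfderiv hW₀ hsmW hbij
  set θ : M → E' := invFunOn Φext W₀ with hθ_def
  have hθsm : ContMDiffOn (𝓡 m) 𝓘(ℝ, E') ∞ θ (Φext '' W₀) :=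
    Literature.Geometry.Manifold.contMDiffOn_invFunOn_of_bijective_mfderiv hW₀ hsmW hinj hbij
  have hθmem : ∀ p ∈ Φext '' W₀, θ p ∈ W₀ := fun p hp ↦
    Literature.Geometry.Manifold.invFunOn_mem hp
  have hΦθ : ∀ p ∈ Φext '' W₀, Φext (θ p) = p := fun p hp ↦
    Literature.Geometry.Manifold.apply_invFunOn hp
  have hθΦ : ∀ u ∈ W₀, θ (Φext u) = u := fun u hu ↦
    Literature.Geometry.Manifold.invFunOn_apply hinj hu
  -- the pushed-forward field
  set ξ : Π p : M, TangentSpace (𝓡 m) p := fun p ↦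
    mfderiv 𝓘(ℝ, E') (𝓡 m) Φext (θ p) (ξc (θ p)) with hξ_def
  have hξΦ : ∀ u ∈ W₀, ξ (Φext u) = mfderiv 𝓘(ℝ, E') (𝓡 m) Φext u (ξc u) := fun u hu ↦ by
    simp only [hξ_def]
    rw [hθΦ u hu]
  -- smoothness of the pushed-forward field on the image
  have hsmooth : ContMDiffOn (𝓡 m) ((𝓡 m).prod 𝓘(ℝ, EuclideanSpace ℝ (Fin m))) ∞
      (fun p ↦ (TotalSpace.mk' (EuclideanSpace ℝ (Fin m)) p (ξ p) : TangentBundle (𝓡 m) M))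
      (Φext '' W₀) := by
    -- the inner map `p ↦ (θ p, ξ̃ (θ p)) ∈ T E'`
    set inner : M → TangentBundle 𝓘(ℝ, E') E' := fun p ↦
      (TotalSpace.mk' E' (θ p) (ξc (θ p) : TangentSpace 𝓘(ℝ, E') (θ p)) :
        TangentBundle 𝓘(ℝ, E') E') with hinner_def
    have hξθ : ContMDiffOn (𝓡 m) 𝓘(ℝ, E') ∞ (fun p ↦ ξc (θ p)) (Φext '' W₀) :=
      hξ.contMDiffOn.comp hθsm fun p hp ↦ hθmem p hp
    have hinner : ContMDiffOn (𝓡 m) 𝓘(ℝ, E').tangent ∞ inner (Φext '' W₀) := by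
      intro x₀ hx₀
      rw [Bundle.contMDiffWithinAt_totalSpace]
      refine ⟨hθsm x₀ hx₀, ?_⟩
      simp only [hinner_def, trivializationAt_model_space_apply]
      exact hξθ x₀ hx₀
    have htan : ContMDiffOn 𝓘(ℝ, E').tangent (𝓡 m).tangent ∞
        (tangentMapWithin 𝓘(ℝ, E') (𝓡 m) Φext W₀)
        (π E' (TangentSpace 𝓘(ℝ, E')) ⁻¹' W₀) :=
      hsmW.contMDiffOn_tangentMapWithin (m := ∞) (by simp) hW₀.uniqueMDiffOn
    have hcomp := htan.comp hinner fun p hp ↦ by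
      simp only [hinner_def, mem_preimage]
      exact hθmem p hp
    refine hcomp.congr fun p hp ↦ ?_
    have h1 : Φext (θ p) = p := hΦθ p hp
    have h2 : mfderivWithin 𝓘(ℝ, E') (𝓡 m) Φext W₀ (θ p) = mfderiv 𝓘(ℝ, E') (𝓡 m) Φext (θ p) :=
      mfderivWithin_of_isOpen hW₀ (hθmem p hp)
    change (TotalSpace.mk' (EuclideanSpace ℝ (Fin m)) p (ξ p) : TangentBundle (𝓡 m) M) =
      TotalSpace.mk' (EuclideanSpace ℝ (Fin m)) (Φext (θ p))
        (mfderivWithin 𝓘(ℝ, E') (𝓡 m) Φext W₀ (θ p) (ξc (θ p)))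
    rw [h2]
    change (TotalSpace.mk' (EuclideanSpace ℝ (Fin m)) p (ξ p) : TangentBundle (𝓡 m) M) =
      TotalSpace.mk' (EuclideanSpace ℝ (Fin m)) (Φext (θ p)) (ξ p)
    rw [h1]
  refine ⟨ξ, hWopen, hsmooth, ?_, hξΦ⟩
  -- the Killing equation at the points of the image
  rintro p ⟨u, hu, rfl⟩
  have huV : u ∈ V := hWV hu
  set u' : V := ⟨u, huV⟩ with hu'_def
  have hpu : Φ u' = Φext u := hext u'
  rw [← hpu]
  intro Y₀ Z₀
  have hsurj := (mfderiv_bijective_of_injective (hΦ' u') hdim).2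
  obtain ⟨Yc, rfl⟩ := hsurj Y₀
  obtain ⟨Zc, rfl⟩ := hsurj Z₀
  have hX : MDifferentiableAt (𝓡 m) ((𝓡 m).prod 𝓘(ℝ, EuclideanSpace ℝ (Fin m)))
      (fun p ↦ (TotalSpace.mk' (EuclideanSpace ℝ (Fin m)) p (ξ p) : TangentBundle (𝓡 m) M))
      (Φ u') := by
    rw [hpu]
    exact (hsmooth.contMDiffAt (hWopen.mem_nhds ⟨u, hu, rfl⟩)).mdifferentiableAt (by simp)
  rw [← PseudoRiemannianMetric.val_leviCivita_mpullback_add g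
    PseudoRiemannianMetric.contMDiff_pullbackBilin_holds hΦ hΦ' hdim hX Yc Zc]
  -- the pulled-back field is `ξ̃` near `u'`
  have hW₀u : ∀ᶠ w : V in 𝓝 u', (w : E') ∈ W₀ :=
    continuous_subtype_val.continuousAt.preimage_mem_nhds (hW₀.mem_nhds hu)
  have hpull : ∀ᶠ w : V in 𝓝 u',
      mpullback 𝓘(ℝ, E') (𝓡 m) Φ ξ w = (ξc w : TangentSpace 𝓘(ℝ, E') w) := by
    filter_upwards [hW₀u] with w hw
    rw [mpullback_apply, hext w, hξΦ w hw]
    have hbw : Function.Bijective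
        (show E' →L[ℝ] EuclideanSpace ℝ (Fin m) from mfderiv 𝓘(ℝ, E') (𝓡 m) Φ w) :=
      mfderiv_bijective_of_injective (hΦ' w) hdim
    set e := Literature.Geometry.Manifold.continuousLinearEquivOfBijective
      (E := E') (E' := EuclideanSpace ℝ (Fin m)) _ hbw with he_def
    have hcoe : (e : E' →L[ℝ] EuclideanSpace ℝ (Fin m)) = mfderiv 𝓘(ℝ, E') (𝓡 m) Φ w :=
      Literature.Geometry.Manifold.coe_continuousLinearEquivOfBijective
        (E := E') (E' := EuclideanSpace ℝ (Fin m)) _ hbw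
    have hde : mfderiv 𝓘(ℝ, E') (𝓡 m) Φext w = (e : E' →L[ℝ] EuclideanSpace ℝ (Fin m)) := by
      rw [hcoe]; exact mfderiv_ext_eq hext hsm w
    change (mfderiv 𝓘(ℝ, E') (𝓡 m) Φ w).inverse (mfderiv 𝓘(ℝ, E') (𝓡 m) Φext w (ξc w)) = ξc w
    rw [hde, ← hcoe]
    change (e : E' →L[ℝ] EuclideanSpace ℝ (Fin m)).inverse (e (ξc w)) = ξc w
    rw [ContinuousLinearMap.inverse_equiv]
    exact e.symm_apply_apply (ξc w)
  -- differentiability of both sections at `u'`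
  have hξcd : DifferentiableAt ℝ ξc u := (hξ.contDiffAt (hW₀.mem_nhds hu)).differentiableAt (by simp)
  have hσ' : MDifferentiableAt 𝓘(ℝ, E') (𝓘(ℝ, E').prod 𝓘(ℝ, E'))
      (fun w : V ↦ (TotalSpace.mk' E' w (ξc w : TangentSpace 𝓘(ℝ, E') w) :
        TangentBundle 𝓘(ℝ, E') V)) u' := by
    rw [OpensChart.mdifferentiableAt_section_iff]
    exact (OpensChart.mdifferentiableAt_iff u' (fun w : V ↦ ξc w) ξc (fun _ ↦ rfl)).2 hξcd
  have hσ : MDifferentiableAt 𝓘(ℝ, E') (𝓘(ℝ, E').prod 𝓘(ℝ, E'))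
      (fun w : V ↦ (TotalSpace.mk' E' w (mpullback 𝓘(ℝ, E') (𝓡 m) Φ ξ w) :
        TangentBundle 𝓘(ℝ, E') V)) u' := by
    refine hσ'.congr_of_eventuallyEq ?_
    filter_upwards [hpull] with w hw
    rw [hw]
  have hcongr : (metric g hΦ hΦ' hdim).leviCivita (mpullback 𝓘(ℝ, E') (𝓡 m) Φ ξ) u' =
      (metric g hΦ hΦ' hdim).leviCivita (fun w : V ↦ (ξc w : TangentSpace 𝓘(ℝ, E') w)) u' :=
    (metric g hΦ hΦ' hdim).leviCivita.isCovariantDerivativeOn.congr_of_eventuallyEq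
      (s := univ) hσ hσ' univ_mem hpull
  have hlc : ∀ X₀ : E', (metric g hΦ hΦ' hdim).leviCivita
      (fun w : V ↦ (ξc w : TangentSpace 𝓘(ℝ, E') w)) u' X₀ =
      fderiv ℝ ξc u X₀ + MetricCoord.chrAt (repr g hΦ hΦ' hdim) u X₀ (ξc u) := fun X₀ ↦ by
    rw [OpensChart.leviCivita_apply_eq hG u' (W := fun w : V ↦ (ξc w : TangentSpace 𝓘(ℝ, E') w))
      (Wf := ξc) (fun _ ↦ rfl) hξcd X₀, OpensChart.christoffel_eq_chrAt hG u']
  change (metric g hΦ hΦ' hdim).val u' ((metric g hΦ hΦ' hdim).leviCivita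
      (mpullback 𝓘(ℝ, E') (𝓡 m) Φ ξ) u' Yc) Zc + (metric g hΦ hΦ' hdim).val u' Yc
      ((metric g hΦ hΦ' hdim).leviCivita (mpullback 𝓘(ℝ, E') (𝓡 m) Φ ξ) u' Zc) = 0
  rw [hcongr, hlc, hlc, hG u']
  change repr g hΦ hΦ' hdim u (fderiv ℝ ξc u Yc + MetricCoord.chrAt (repr g hΦ hΦ' hdim) u Yc (ξc u)) Zc +
      repr g hΦ hΦ' hdim u Yc (fderiv ℝ ξc u Zc + MetricCoord.chrAt (repr g hΦ hΦ' hdim) u Zc (ξc u)) = 0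
  rw [map_add, _root_.add_apply, map_add, ← hkill u hu Yc Zc,
    ← apply_chrAt_add_apply_chrAt hmet huV (ξc u) Yc Zc]
  ring

end ImmersionChart

end Literature.Geometry.Lorentzian

end
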